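import Literature.Geometry.Lorentzian.CoordWeightedPoincareBoundary
import Literature.Geometry.Lorentzian.CoordMomentumPairingIntegral
import HarnessLib

/-!
# Weighted integral identities for vector fields (Chruściel–Delay 2003, App. D, Lemma D.1, Prop. D.2)

Topic `Literature/Geometry/Lorentzian`, coordinate tensor calculus `MetricCoord` (Riemannian metric
components `G` on an open set `V`). Everything here is PROVED; no definition and no statement of
`Prop` type is introduced.

The vector-field half of the weighted estimates of Chruściel–Delay (Mém. SMF 94 (2003)), App. D,
for the **Killing operator** `S(Y) = ½ 𝓛_Y g = sym G(∇Y·, ·)` (`symAt ((G x).comp (covDAt G Y x))`,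
cf. `IsMetricOn.lieFormAt_metric_eq_symAt`; `tr S(Y) = div Y`):

* `IsMetricOn.fderiv_metric_pairing` — metric compatibility on fields,
  `∂_Z G(Y, W) = G(∇_Z Y, W) + G(Y, ∇_Z W)`;
* `IsMetricOn.weightedVector_pointwise` — the Green identity behind Prop. D.2: for fields `Y, W`
  and a function `u` smooth on `V`,
  `e^{2u} [ S(Y)(Y,W) + ½ (div Y) G(Y,W) + ½ G(∇_Y W, Y) + ¼ (div W) |Y|² + ½ du(W) |Y|² + du(Y) G(Y,W) ]
   = div_G ( e^{2u} (½ G(Y,W) Y + ¼ |Y|² W) )`;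
* **`IsMetricOn.integral_weightedVector`** — **Prop. D.2** (Lemma D.1 is `u = 0`): for `Y` smooth
  with compact support inside `V` and `W, u` smooth on `V`,
  `∫ √det g · e^{2u} [S(Y) + ½ tr S(Y) g](Y, W) dμ
     = −∫ √det g · e^{2u} [ ½ G(∇_Y W, Y) + ¼ (div W)|Y|² + ½ du(W)|Y|² + du(Y) G(Y, W) ] dμ`.
  (The printed right-hand side reads `½ ∇W(Y,Y) + ½ div(V)|Y|² + ⟨du,V⟩|Y|² + 2⟨du,Y⟩⟨V,Y⟩` inside
  `−½ ∫ e^{2u}{…}`; the coefficients proved here are the ones the integration by parts gives,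
  `½, ¼, ½, 1` — the combination `(s/2)(|dx|²|Y|² + 2⟨Y,∇x⟩²)` of Cor. D.5 is what they produce.)

With `W = ∇x/x²`, `u = −s/x + t log x` this is Cor. D.5, the vector half of the coercivity
estimate (3.4) near the boundary (Thm. 5.6) behind Thm. 5.9, i.e. behind the compact-annulus
hypothesis `(E)` of `ChruscielDelay_parametricAnnulusGluing_of_compactCore`.

## References

* P. T. Chruściel, E. Delay, Mém. Soc. Math. Fr. 94 (2003), App. D, Lemma D.1, Prop. D.2,
  Cor. D.5. [ChruscielDelay2003]
* B. O'Neill, *Semi-Riemannian geometry*, 1983, Ch. 3, Prop. 3.13; Ch. 7, Lemma 7.21. [ONeill1983]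
-/

noncomputable section

set_option maxSynthPendingDepth 3

open Set Filter Module Function MeasureTheory
open scoped Topology ContDiff

namespace Literature.Geometry.Lorentzian

namespace MetricCoord

variable {E : Type*} [NormedAddCommGroup E] [NormedSpace ℝ E] [FiniteDimensional ℝ E]
  [CompleteSpace E] {ι : Type*} [Fintype ι] [DecidableEq ι] (b : Basis ι ℝ E)
  {G : E → E →L[ℝ] E →L[ℝ] ℝ} {V : Set E} {x : E} {Y W : E → E} {u : E → ℝ}

/-! ### Metric compatibility on fields -/

omit [FiniteDimensional ℝ E] [CompleteSpace E] in
/-- **Metric compatibility on fields**: `∂_Z G(Y,W) = G(∇_Z Y, W) + G(Y, ∇_Z W)` for fields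
`Y, W` differentiable at `x ∈ V` (O'Neill 1983, Ch. 3, Prop. 3.13 with Thm. 3.11 (D4)).
[cite: ONeill1983, Ch. 3, Prop. 3.13] -/
theorem IsMetricOn.fderiv_metric_pairing (hG : IsMetricOn G V) (hx : x ∈ V)
    (hY : DifferentiableAt ℝ Y x) (hW : DifferentiableAt ℝ W x) (Z : E) :
    fderiv ℝ (fun y ↦ G y (Y y) (W y)) x Z =
      G x (covDAt G Y x Z) (W x) + G x (Y x) (covDAt G W x Z) := by
  have h1 : HasFDerivAt (fun y ↦ G y (Y y))
      ((G x).comp (fderiv ℝ Y x) + (fderiv ℝ G x).flip (Y x)) x :=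
    (hG.differentiableAt hx).hasFDerivAt.clm_apply hY.hasFDerivAt
  have h2 : HasFDerivAt (fun y ↦ G y (Y y) (W y))
      ((G x (Y x)).comp (fderiv ℝ W x) +
        ((G x).comp (fderiv ℝ Y x) + (fderiv ℝ G x).flip (Y x)).flip (W x)) x :=
    h1.clm_apply hW.hasFDerivAt
  rw [h2.fderiv]
  simp only [_root_.add_apply, ContinuousLinearMap.comp_apply, ContinuousLinearMap.flip_apply,
    covDAt_apply, map_add, hG.fderiv_eq_chrAt hx Z (Y x) (W x), hG.chrAt_comm hx (Y x) Z,
    hG.chrAt_comm hx (W x) Z]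
  ring

/-! ### The pointwise identity of Prop. D.2 -/

omit [CompleteSpace E] in
/-- **The Green identity behind Prop. D.2** (Chruściel–Delay 2003, proofs of Lemma D.1 and
Prop. D.2): for fields `Y, W` and a function `u` smooth on `V`, at `x ∈ V`,
`e^{2u} [ S(Y)(Y,W) + ½ (div Y) G(Y,W) + ½ G(∇_Y W, Y) + ¼ (div W)|Y|² + ½ du(W)|Y|² + du(Y) G(Y,W) ]
 = div_G (e^{2u} (½ G(Y,W) Y + ¼ |Y|² W))` (Leibniz rule for `div`, metric compatibility).
[cite: ChruscielDelay2003, App. D, Prop. D.2] -/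
theorem IsMetricOn.weightedVector_pointwise (hG : IsMetricOn G V) (hx : x ∈ V)
    (hY : ContDiffOn ℝ ∞ Y V) (hW : ContDiffOn ℝ ∞ W V) (hu : ContDiffOn ℝ ∞ u V) :
    Real.exp (2 * u x) *
        (symAt ((G x).comp (covDAt G Y x)) (Y x) (W x)
          + 2⁻¹ * divAt G Y x * G x (Y x) (W x)
          + 2⁻¹ * G x (covDAt G W x (Y x)) (Y x)
          + 4⁻¹ * divAt G W x * G x (Y x) (Y x)
          + 2⁻¹ * fderiv ℝ u x (W x) * G x (Y x) (Y x)
          + fderiv ℝ u x (Y x) * G x (Y x) (W x)) =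
      divAt G (fun y ↦ Real.exp (2 * u y) •
        ((2⁻¹ * G y (Y y) (W y)) • Y y + (4⁻¹ * G y (Y y) (Y y)) • W y)) x := by
  have hxs : V ∈ 𝓝 x := hG.mem_nhds hx
  have hs := hG.symm x hx
  have hYd : DifferentiableAt ℝ Y x := ((hY x hx).contDiffAt hxs).differentiableAt (by simp)
  have hWd : DifferentiableAt ℝ W x := ((hW x hx).contDiffAt hxs).differentiableAt (by simp)
  have hud : DifferentiableAt ℝ u x := ((hu x hx).contDiffAt hxs).differentiableAt (by simp)
  have hGd : DifferentiableAt ℝ G x := hG.differentiableAt hx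
  -- the coefficient functions
  have hfd : DifferentiableAt ℝ (fun y ↦ 2⁻¹ * G y (Y y) (W y)) x :=
    ((hGd.clm_apply hYd).clm_apply hWd).const_mul _
  have hhd : DifferentiableAt ℝ (fun y ↦ 4⁻¹ * G y (Y y) (Y y)) x :=
    ((hGd.clm_apply hYd).clm_apply hYd).const_mul _
  have hed : DifferentiableAt ℝ (fun y ↦ Real.exp (2 * u y)) x := (hud.const_mul _).exp
  have hB₀d : DifferentiableAt ℝ
      (fun y ↦ (2⁻¹ * G y (Y y) (W y)) • Y y + (4⁻¹ * G y (Y y) (Y y)) • W y) x :=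
    (hfd.smul hYd).add (hhd.smul hWd)
  -- derivatives of the coefficients
  have hfder : fderiv ℝ (fun y ↦ 2⁻¹ * G y (Y y) (W y)) x =
      (2⁻¹ : ℝ) • fderiv ℝ (fun y ↦ G y (Y y) (W y)) x :=
    fderiv_const_mul ((hGd.clm_apply hYd).clm_apply hWd) _
  have hhder : fderiv ℝ (fun y ↦ 4⁻¹ * G y (Y y) (Y y)) x =
      (4⁻¹ : ℝ) • fderiv ℝ (fun y ↦ G y (Y y) (Y y)) x :=
    fderiv_const_mul ((hGd.clm_apply hYd).clm_apply hYd) _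
  have heder : fderiv ℝ (fun y ↦ Real.exp (2 * u y)) x =
      Real.exp (2 * u x) • ((2 : ℝ) • fderiv ℝ u x) := by
    rw [((hud.hasFDerivAt.const_mul (2 : ℝ)).exp).fderiv]
  -- expand the divergence
  have hdiv : divAt G (fun y ↦ (2⁻¹ * G y (Y y) (W y)) • Y y + (4⁻¹ * G y (Y y) (Y y)) • W y) x =
      divAt G (fun y ↦ (2⁻¹ * G y (Y y) (W y)) • Y y) x
        + divAt G (fun y ↦ (4⁻¹ * G y (Y y) (Y y)) • W y) x :=
    divAt_add (hfd.smul hYd) (hhd.smul hWd)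
  rw [divAt_smul hed hB₀d, hdiv, divAt_smul hfd hYd, divAt_smul hhd hWd, hfder, hhder, heder]
  simp only [_root_.smul_apply, smul_eq_mul, map_add, map_smul,
    hG.fderiv_metric_pairing hx hYd hWd, hG.fderiv_metric_pairing hx hYd hYd, symAt_apply,
    ContinuousLinearMap.comp_apply]
  -- normalise the metric pairings
  rw [hs (Y x) (covDAt G W x (Y x)), hs (Y x) (covDAt G Y x (W x))]
  ring

/-! ### Prop. D.2 integrated -/

omit [NormedSpace ℝ E] [FiniteDimensional ℝ E] [CompleteSpace E] [Fintype ι] [DecidableEq ι] in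
/-- A function continuous at the points of `V` and locally zero off a compact subset of `V`
is continuous with compact support. [folklore] -/
private theorem continuous_and_hasCompactSupport_of'' {k : E → ℝ} {S : Set E} (hSV : S ⊆ V)
    (hS : IsCompact S) (hk : ∀ y ∈ V, ContinuousAt k y) (hk0 : ∀ y ∉ S, k =ᶠ[𝓝 y] fun _ ↦ 0) :
    Continuous k ∧ HasCompactSupport k := by
  refine ⟨continuous_iff_continuousAt.2 fun y ↦ ?_, ?_⟩
  · by_cases hy : y ∈ S
    · exact hk y (hSV hy)
    · exact (continuousAt_const.congr_of_eventuallyEq (hk0 y hy) :)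
  · refine HasCompactSupport.of_support_subset_isCompact hS fun y hy ↦ ?_
    by_contra hyS
    exact hy (hk0 y hyS).self_of_nhds

section Integral

variable [MeasurableSpace E] [BorelSpace E] (μ : Measure E) [μ.IsAddHaarMeasure]

omit [FiniteDimensional ℝ E] [CompleteSpace E] in
/-- **Integrability bookkeeping for vector fields**: a density `k` smooth on `V` vanishing wherever
the compactly supported field `Y` vanishes is integrable against `√det g`. [folklore] -/
theorem IsMetricOn.integrable_sqrtDetGram_mul_of_vanishing_vec (hG : IsMetricOn G V)
    (hpos : ∀ y ∈ V, ∀ e : E, e ≠ 0 → 0 < G y e e)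
    (hsupp : HasCompactSupport Y) (hYV : tsupport Y ⊆ V)
    {k : E → ℝ} (hk : ContDiffOn ℝ ∞ k V) (hk0 : ∀ z, Y z = 0 → k z = 0) :
    Integrable (fun z ↦ sqrtDetGram G b z * k z) μ := by
  have hsg : ContDiffOn ℝ ∞ (sqrtDetGram G b) V := hG.contDiffOn_sqrtDetGram b hpos
  have cont : ∀ y ∈ V, ContinuousAt (fun z ↦ sqrtDetGram G b z * k z) y := fun y hy ↦
    ((hsg.continuousOn.continuousWithinAt hy).continuousAt (hG.mem_nhds hy)).mul
      ((hk.continuousOn.continuousWithinAt hy).continuousAt (hG.mem_nhds hy))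
  obtain ⟨hc, hcs⟩ := continuous_and_hasCompactSupport_of'' hYV hsupp cont fun y hy ↦
    (notMem_tsupport_iff_eventuallyEq.mp hy).mono fun z hz ↦ by
      simp only [hk0 z hz, mul_zero]
  exact hc.integrable_of_hasCompactSupport hcs

/-- **Prop. D.2 of Chruściel–Delay 2003** (App. D; Lemma D.1 is the case `u = 0`): for Riemannian
metric components `G` on `V`, a field `Y` smooth on `V` with compact support inside `V`, a field
`W` and a function `u` smooth on `V`,
`∫ √det g · e^{2u} [ S(Y)(Y,W) + ½ (div Y) G(Y,W) ] dμ
  = −∫ √det g · e^{2u} [ ½ G(∇_Y W, Y) + ¼ (div W)|Y|² + ½ du(W)|Y|² + du(Y) G(Y,W) ] dμ`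
(`S(Y) = sym G(∇Y·,·)`, `tr S(Y) = div Y`; integrate `weightedVector_pointwise` with the coordinate
divergence theorem). [cite: ChruscielDelay2003, App. D, Prop. D.2] -/
theorem IsMetricOn.integral_weightedVector (hG : IsMetricOn G V)
    (hpos : ∀ y ∈ V, ∀ e : E, e ≠ 0 → 0 < G y e e)
    (hY : ContDiffOn ℝ ∞ Y V) (hsupp : HasCompactSupport Y) (hYV : tsupport Y ⊆ V)
    (hW : ContDiffOn ℝ ∞ W V) (hu : ContDiffOn ℝ ∞ u V) :
    ∫ y, sqrtDetGram G b y * (Real.exp (2 * u y) *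
        (symAt ((G y).comp (covDAt G Y y)) (Y y) (W y)
          + 2⁻¹ * divAt G Y y * G y (Y y) (W y))) ∂μ =
      -∫ y, sqrtDetGram G b y * (Real.exp (2 * u y) *
        (2⁻¹ * G y (covDAt G W y (Y y)) (Y y)
          + 4⁻¹ * divAt G W y * G y (Y y) (Y y)
          + 2⁻¹ * fderiv ℝ u y (W y) * G y (Y y) (Y y)
          + fderiv ℝ u y (Y y) * G y (Y y) (W y))) ∂μ := by
  set f₁ : E → ℝ := fun y ↦ Real.exp (2 * u y) *
      (symAt ((G y).comp (covDAt G Y y)) (Y y) (W y)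
        + 2⁻¹ * divAt G Y y * G y (Y y) (W y)) with hf₁
  set f₂ : E → ℝ := fun y ↦ Real.exp (2 * u y) *
      (2⁻¹ * G y (covDAt G W y (Y y)) (Y y)
        + 4⁻¹ * divAt G W y * G y (Y y) (Y y)
        + 2⁻¹ * fderiv ℝ u y (W y) * G y (Y y) (Y y)
        + fderiv ℝ u y (Y y) * G y (Y y) (W y)) with hf₂
  set B : E → E := fun y ↦ Real.exp (2 * u y) •
      ((2⁻¹ * G y (Y y) (W y)) • Y y + (4⁻¹ * G y (Y y) (Y y)) • W y) with hBdef
  -- vanishing where `Y` vanishes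
  have hf₁0 : ∀ z, Y z = 0 → f₁ z = 0 := fun z hz ↦ by
    simp only [hf₁, hz, map_zero, _root_.zero_apply, symAt_apply, ContinuousLinearMap.comp_apply,
      mul_zero, add_zero]
  have hf₂0 : ∀ z, Y z = 0 → f₂ z = 0 := fun z hz ↦ by
    simp only [hf₂, hz, map_zero, _root_.zero_apply, mul_zero, add_zero]
  have hB0 : ∀ z, Y z = 0 → B z = 0 := fun z hz ↦ by
    simp only [hBdef, hz, map_zero, _root_.zero_apply, mul_zero, zero_smul, smul_zero, add_zero]
  -- smoothness on `V`
  have hpair : ∀ {Y' W' : E → E}, ContDiffOn ℝ ∞ Y' V → ContDiffOn ℝ ∞ W' V →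
      ContDiffOn ℝ ∞ (fun y ↦ G y (Y' y) (W' y)) V := fun hY' hW' ↦
    (hG.contDiffOn.clm_apply hY').clm_apply hW'
  have heu : ContDiffOn ℝ ∞ (fun y ↦ Real.exp (2 * u y)) V := (contDiffOn_const.mul hu).exp
  have hdu : ContDiffOn ℝ ∞ (fderiv ℝ u) V := hu.fderiv_of_isOpen hG.isOpen (by simp)
  have hcovY : ContDiffOn ℝ ∞ (covDAt G Y) V := hG.contDiffOn_covDAt hY
  have hcovW : ContDiffOn ℝ ∞ (covDAt G W) V := hG.contDiffOn_covDAt hW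
  have hS : ContDiffOn ℝ ∞ (fun y ↦ symAt ((G y).comp (covDAt G Y y)) (Y y) (W y)) V := by
    have h : ContDiffOn ℝ ∞ (fun y ↦ symAt ((G y).comp (covDAt G Y y))) V :=
      contDiffOn_symAt (hG.contDiffOn.clm_comp hcovY)
    exact (h.clm_apply hY).clm_apply hW
  have hf₁s : ContDiffOn ℝ ∞ f₁ V :=
    heu.mul (hS.add ((contDiffOn_const.mul (hG.contDiffOn_divAt hY)).mul (hpair hY hW)))
  have hf₂s : ContDiffOn ℝ ∞ f₂ V := by
    refine heu.mul ((((contDiffOn_const.mul ?_).add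
      ((contDiffOn_const.mul (hG.contDiffOn_divAt hW)).mul (hpair hY hY))).add
      ((contDiffOn_const.mul (hdu.clm_apply hW)).mul (hpair hY hY))).add
      ((hdu.clm_apply hY).mul (hpair hY hW)))
    exact (hG.contDiffOn.clm_apply (hcovW.clm_apply hY)).clm_apply hY
  have hBs : ContDiffOn ℝ ∞ B V :=
    heu.smul (((contDiffOn_const.mul (hpair hY hW)).smul hY).add
      ((contDiffOn_const.mul (hpair hY hY)).smul hW))
  have hBsupp : HasCompactSupport B :=
    hsupp.mono' fun y hy ↦ by
      by_contra hyY
      exact hy (hB0 y (image_eq_zero_of_notMem_tsupport hyY))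
  have hBV : tsupport B ⊆ V := by
    refine (closure_minimal (fun y hy ↦ ?_) (isClosed_tsupport Y)).trans hYV
    by_contra hyY
    exact hy (hB0 y (image_eq_zero_of_notMem_tsupport hyY))
  -- off `V`
  have hoff : ∀ y ∉ V, Y y = 0 := fun y hy ↦
    image_eq_zero_of_notMem_tsupport fun h' ↦ hy (hYV h')
  -- integrate `f₁ + f₂ = div B`
  have hI₁ := hG.integrable_sqrtDetGram_mul_of_vanishing_vec b μ hpos hsupp hYV hf₁s hf₁0
  have hI₂ := hG.integrable_sqrtDetGram_mul_of_vanishing_vec b μ hpos hsupp hYV hf₂s hf₂0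
  have hGreen : ∫ y, sqrtDetGram G b y * (f₁ y + f₂ y) ∂μ =
      ∫ y, sqrtDetGram G b y * (0 : ℝ) ∂μ := by
    refine hG.integral_sqrtDetGram_mul_eq_of_eq_add_divAt b μ hpos hBs hBsupp hBV
      (fun y hy ↦ ?_) (fun y hy ↦ ?_) (fun _ _ ↦ rfl) (by simp)
    · rw [zero_add, ← hG.weightedVector_pointwise hy hY hW hu]
      simp only [hf₁, hf₂]
      ring
    · rw [hf₁0 y (hoff y hy), hf₂0 y (hoff y hy), add_zero]
  simp only [mul_zero, integral_zero] at hGreen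
  have hsplit : ∫ y, sqrtDetGram G b y * (f₁ y + f₂ y) ∂μ =
      (∫ y, sqrtDetGram G b y * f₁ y ∂μ) + ∫ y, sqrtDetGram G b y * f₂ y ∂μ := by
    simp_rw [mul_add]
    exact integral_add hI₁ hI₂
  have key : (∫ y, sqrtDetGram G b y * f₁ y ∂μ) = -∫ y, sqrtDetGram G b y * f₂ y ∂μ := by
    linarith [hGreen, hsplit]
  simpa only [hf₁, hf₂] using key

end Integral

end MetricCoord

end Literature.Geometry.Lorentzian

end
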